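import Mathlib
import Literature.AlgebraicGeometry.HodgeTheory.WeilClasses
import Literature.AlgebraicGeometry.Motives.AbelianVarietyProduct

/-!
# Crux-ideate round 2, ideator 5 — first lemmas for the two crux idea cards on
`HodgeAbelianVarieties` (stmt-HodgeConjecture-1333)

Card `tannakian-charge-dichotomy`:
* `KStablePullbackPositive` (signature): the class line of a `φ`-stable irreducible closed subset of
  codimension `≥ n` is an eigenline of `φ^*` with POSITIVE real eigenvalue (paper: `φ⁻¹(Z) = Z + ker φ`,
  translates are homologous, multiplicities are positive).
* `weil_component_eq_zero_of_pos_eigen` (PROVED): a class `c` with `φ^* c = λ • c`, `λ > 0`, lying in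
  the Weil plane `weilClassesOf A φ n d` vanishes when `n` is odd and `d > 0`, because `φ^*` acts on
  both Weil eigen-lines by `(± i √d)^{2n} = (-d)^n < 0`.  Together: in odd half-dimension no
  `φ`-stable irreducible cycle (abelian subvariety stable under `O_K`, theta-locus for `K = ℚ(i)`, …)
  carries a Weil component — the first BLIND SPOT of the exotic-witness search.

Card `real-quadratic-doubling`:
* `twinWeilClasses` (definition over existing carriers) = the complexified plane of Weil classes of
  `(A × A, L = K·ℚ(√m))`, `ℚ(√m)` acting through `Ψ(a,b) = (m b, a)`, `K` through `Φ = φ × φ`;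
* `RestrictionSurjective` (signature): restriction along `a ↦ (a, 0)` maps `W_L(A × A)` ONTO
  `W_K(A)` (paper: the `(2n,0)`-Künneth component of `⋀_i (√m eᵢ, eᵢ)` is `mⁿ · w`);
* `DiscriminantMerging` (signature, elementary arithmetic): for all `d, q > 0` there are a positive
  non-square `m` and `a, b, s` with `q s² = a² + d m b²`, i.e. `q ∈ Nm(ℚ(√-dm)^×) · ℚ^{×2}`, so any
  two discriminant classes of the same sign become equal in `F^×/N_{L/F}(L^×)`, `F = ℚ(√m)`.
-/

open CategoryTheory

set_option linter.dupNamespace false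

namespace Summit.HodgeConjecture.HodgeConjecture.Cruxes.HodgeAbelianVarieties.IdeatorFive

open Literature.AlgebraicGeometry Literature.AlgebraicGeometry.HodgeTheory
  Literature.AlgebraicGeometry.Motives Literature.AlgebraicTopology.SingularHomology

universe u

/-- Pull-back of a degree-`k` complex Betti class along an endomorphism of abelian varieties
(the literal shape used in `HodgeTheory/WeilClasses`). -/
noncomputable abbrev pb {A B : AbelianVariety ℂ} (ψ : A ⟶ B) (k : ℕ) :
    complexBetti B.X k →ₗ[ℂ] complexBetti A.X k :=
  (singularCohomology.map ℂ ℂ (Motives.AlgPoints.mapContinuous (L := ℂ) ψ.hom.hom.hom) k).hom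

/-- **K-stable cycles pull back positively** (signature; paper proof: for `Z` irreducible closed of
codimension `≥ n` with `φ(Z) ⊆ Z` one has `φ(Z) = Z`, `φ⁻¹(Z) = Z + ker φ` is a union of
translates of `Z`, translates are homologous and multiplicities are positive, so `φ^*` acts on the
line `H^{2n}_Z(A) = ker (H^{2n}(A) → H^{2n}(A ∖ Z))` by a positive rational scalar). -/
def KStablePullbackPositive : Prop :=
  ∀ (n : ℕ) (A : AbelianVariety ℂ) (φ : A ⟶ A) (Z : Set A.X.left),
    IsClosed Z → IsIrreducible Z →
    (∀ z ∈ Z, ((n : ℕ) : ℕ∞) ≤ Order.coheight z) →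
    (AbelianVariety.Hom.toSchemeHom φ).base '' Z ⊆ Z →
    ∀ c ∈ LinearMap.ker (complexBetti.restrictCompl A.X Z (2 * n)).hom,
      ∃ t : ℝ, 0 < t ∧ pb φ (2 * n) c = (t : ℂ) • c

/-- `(0 • 𝟙 + 1 • φ) = φ` in the preadditive category of abelian varieties. -/
theorem zero_smul_id_add_one_smul {A : AbelianVariety ℂ} (φ : A ⟶ A) :
    ((0 : ℕ) • 𝟙 A + (1 : ℕ) • φ : A ⟶ A) = φ := by
  simp

/-- `(± i √d)^{2n} = (-d)^n` in `ℂ`. -/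
theorem I_mul_sqrt_pow_two_mul (d n : ℕ) (ε : ℂ) (hε : ε = 1 ∨ ε = -1) :
    (ε * Complex.I * (Real.sqrt d : ℂ)) ^ (2 * n) = (-(d : ℂ)) ^ n := by
  have hsq : ((Real.sqrt d : ℂ)) ^ 2 = (d : ℂ) := by
    rw [← Complex.ofReal_pow, Real.sq_sqrt (Nat.cast_nonneg d)]
    simp
  have hε2 : ε ^ 2 = 1 := by
    rcases hε with rfl | rfl <;> norm_num
  rw [pow_mul]
  congr 1
  calc (ε * Complex.I * (Real.sqrt d : ℂ)) ^ 2
      = ε ^ 2 * Complex.I ^ 2 * ((Real.sqrt d : ℂ)) ^ 2 := by ring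
    _ = -(d : ℂ) := by rw [hε2, Complex.I_sq, hsq]; ring

/-- **Blind spot 1 (PROVED): in odd half-dimension a positively-pulled-back class has no Weil
component.** If `φ^* c = t • c` with `t > 0` real and `c` lies in the Weil plane of `(A, φ)`,
`φ ≫ φ = -d` intended, `d > 0`, `n` odd, then `c = 0`: on `E₊` and `E₋` the endomorphism
`φ = 0·𝟙 + 1·φ` pulls back by `(i√d)^{2n} = (-i√d)^{2n} = (-d)^n = -dⁿ < 0 ≠ t`. Combined with
`KStablePullbackPositive`: no `φ`-stable irreducible cycle of codimension `n` has a class in the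
Weil plane, and (paper, same argument on the `W`-component) its `W`-component is zero. -/
theorem weil_component_eq_zero_of_pos_eigen {n d : ℕ} (hn : Odd n) (hd : 0 < d)
    {A : AbelianVariety ℂ} (φ : A ⟶ A) {c : complexBetti A.X (2 * n)} {t : ℝ} (ht : 0 < t)
    (heig : pb φ (2 * n) c = (t : ℂ) • c) (hc : c ∈ weilClassesOf A φ n d) : c = 0 := by
  obtain ⟨c₁, c₂, rfl, h₁, h₂⟩ := mem_weilClassesOf_iff.mp hc
  have e₁ := h₁ 0 1
  have e₂ := h₂ 0 1
  rw [zero_smul_id_add_one_smul] at e₁ e₂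
  have k₁ : ((0 : ℕ) : ℂ) + ((1 : ℕ) : ℂ) * Complex.I * (Real.sqrt d : ℂ)
      = 1 * Complex.I * (Real.sqrt d : ℂ) := by push_cast; ring
  have k₂ : ((0 : ℕ) : ℂ) - ((1 : ℕ) : ℂ) * Complex.I * (Real.sqrt d : ℂ)
      = (-1) * Complex.I * (Real.sqrt d : ℂ) := by push_cast; ring
  rw [k₁, I_mul_sqrt_pow_two_mul d n 1 (Or.inl rfl)] at e₁
  rw [k₂, I_mul_sqrt_pow_two_mul d n (-1) (Or.inr rfl)] at e₂
  -- `φ^* (c₁ + c₂) = (-d)^n • (c₁ + c₂)`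
  have hφ : pb φ (2 * n) (c₁ + c₂) = (-(d : ℂ)) ^ n • (c₁ + c₂) := by
    rw [map_add, smul_add]
    exact congrArg₂ (· + ·) e₁ e₂
  have hneg : (-(d : ℂ)) ^ n = -((d : ℂ) ^ n) := Odd.neg_pow hn _
  have key : ((t : ℂ) + (d : ℂ) ^ n) • (c₁ + c₂) = 0 := by
    rw [add_smul, ← heig, hφ, hneg, neg_smul, neg_add_cancel]
  have hne : ((t : ℂ) + (d : ℂ) ^ n) ≠ 0 := by
    have : (0 : ℝ) < t + (d : ℝ) ^ n := by positivity
    have h' : ((t : ℂ) + (d : ℂ) ^ n) = ((t + (d : ℝ) ^ n : ℝ) : ℂ) := by push_cast; ring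
    rw [h']
    exact_mod_cast this.ne'
  exact (smul_eq_zero.mp key).resolve_left hne

/-! ## Card `real-quadratic-doubling` -/

section Twin

variable (A : AbelianVariety ℂ) (φ : A ⟶ A) (m : ℕ)

/-- `Φ = φ × φ` on `A × A` (the diagonal `K`-action). -/
noncomputable def PhiSq : A.prod A ⟶ A.prod A :=
  AbelianVariety.prodLift (AbelianVariety.fst A A ≫ φ) (AbelianVariety.snd A A ≫ φ)

/-- `Ψ(a, b) = (m·b, a)` on `A × A`: `Ψ ≫ Ψ = m`, the action of `√m ∈ O_F`, `F = ℚ(√m)`, so that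
`A × A = A ⊗_ℤ ℤ[√m]` carries `L = K·F`. -/
noncomputable def PsiSq : A.prod A ⟶ A.prod A :=
  AbelianVariety.prodLift (m • AbelianVariety.snd A A) (AbelianVariety.fst A A)

/-- The inclusion of the first factor `a ↦ (a, 0)`. -/
noncomputable def inl : A ⟶ A.prod A :=
  AbelianVariety.prodLift (𝟙 A) 0

/-- **The complexified plane `W_L ⊗ ℂ` of Weil classes of `(A × A, L)`, `L = ℚ(√-d, √m)`**: the sum
over the four sign choices `(ε, ε')` of the joint eigenclasses `c ∈ H^{2n}((A × A)(ℂ); ℂ)` with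
`(x·𝟙 + y·Φ)^* c = (x + ε·i·y·√d)^{2n} c` and `(x·𝟙 + y·Ψ)^* c = (x + ε'·y·√m)^{2n} c` for all
`x y : ℕ` (each a line `⋀^{2n}` of the `(σ, τ)`-eigenspace `{(√m u, u) : u ∈ V_σ}` of `H¹`). -/
noncomputable def twinWeilClasses (n d : ℕ) : Submodule ℂ (complexBetti (A.prod A).X (2 * n)) :=
  ⨆ (s : Bool × Bool),
    (pullbackEigenclasses (A.prod A) (PhiSq A φ) (2 * n)
        (fun x y => ((x : ℂ) + (if s.1 then 1 else -1) * (y : ℂ) * Complex.I * (Real.sqrt d : ℂ))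
          ^ (2 * n))) ⊓
    (pullbackEigenclasses (A.prod A) (PsiSq A m) (2 * n)
        (fun x y => ((x : ℂ) + (if s.2 then 1 else -1) * (y : ℂ) * (Real.sqrt m : ℂ)) ^ (2 * n)))

end Twin

/-- **Restriction is onto** (signature; paper: the `(σ,τ)`-line is spanned by
`⋀ᵢ (√m eᵢ, eᵢ) = Σ_I (√m)^{|I|} e_I ⊠ e_{I^c}` whose `(2n, 0)`-Künneth component, i.e. its restriction
to `A × {0}`, is `mⁿ · e₁ ∧ … ∧ e_{2n} = mⁿ · w_σ ≠ 0`; summing over `τ, τ'` with coefficients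
`λ, λ'` the restriction is `mⁿ (λ + λ') w_σ`, zero only on the codimension-2 subspace
`Tr_{L/K} = 0`). Consequence: `W_K(A)` is algebraic iff `W_L(A ⊗ O_F)` is, for one / every real
quadratic `F` — no descending step. -/
def RestrictionSurjective : Prop :=
  ∀ (n d m : ℕ), 1 ≤ n → 0 < d → 0 < m → ¬ IsSquare m →
    ∀ (A : AbelianVariety ℂ) (φ : A ⟶ A), A.dim = 2 * n → φ ≫ φ = -(d • 𝟙 A) →
      ∀ c ∈ weilClassesOf A φ n d,
        ∃ C ∈ twinWeilClasses A φ m n d, pb (inl A) (2 * n) C = c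

/-- **Discriminant merging** (signature, elementary): every positive rational `q` is, up to rational
squares, a norm from SOME imaginary quadratic field `ℚ(√-dm)` with `m` a positive non-square; hence
for `K = ℚ(√-d)` and any two discriminant classes `δ, δ'` of the same sign in `ℚ^×/Nm(K^×)` there is
a real quadratic `F = ℚ(√m)` with `δ/δ' ∈ N_{L/F}(L^×)`, `L = K F` (take `x ∈ K' = ℚ(√-dm) ⊂ L`:
`N_{L/F} x = x x̄ = N_{K'/ℚ} x`), so that `A_δ ⊗ O_F` and `A_{δ'} ⊗ O_F` are points of one and the
same `L`-Weil Shimura variety (Landherr: rank, signatures, discriminant classify). -/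
def DiscriminantMerging : Prop :=
  ∀ d q : ℕ, 0 < d → 0 < q →
    ∃ m a b s : ℕ, 0 < m ∧ ¬ IsSquare m ∧ 0 < b ∧ 0 < s ∧ q * s ^ 2 = a ^ 2 + d * m * b ^ 2

end Summit.HodgeConjecture.HodgeConjecture.Cruxes.HodgeAbelianVarieties.IdeatorFive
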